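/-
Copyright (c) 2026. Released under the Apache 2.0 license.
-/
import Literature.NumberTheory.EllipticCurves.ManinConstantGamma1ModularDegree
import Literature.NumberTheory.EllipticCurves.Isogeny
import HarnessLib

/-!
# Stevens' minimal-lattice theorem in conductor `≤ 200`: `ℒ(f) = ℒ(A_min)` (Stevens 1989, Theorem (7.1))

The source. G. Stevens, *Stickelberger elements and modular parametrizations of elliptic curves*,
Invent. Math. 98 (1989), 75–106, doi:10.1007/BF01388845 (bib key `Stevens1989Invent`).  The held
store copy `paper:doi-10-1007-bf01388845` is a text-less scan; the statements below are quoted from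
the Göttingen digitisation (GDZ, PPN356556735_0098, printed pp. 75–106) as transcribed in the cell
file `run/shared/lean/pub/pub-bsdpct/pub-bsdpct-1-g48/stevens/` (OCR `p0084.txt`, `p0088.txt`,
`p0104.txt`; excerpt sheet `EXCERPTS.md`).

THE PRINTED THEOREM (§7 "Numerical evidence", p. 104), verbatim:
«(7.1) **Theorem.** Conjecture I is true for the 749 elliptic curves (281 isogeny classes) of
conductor less than or equal to 200 listed in the Antwerp tables [22].»  Followed by (p. 104):
«For computational purposes, it is easier to verify Conjecture I″ (2.8). Thus, for each isogeny
class we must show ℒ(A_min) = ℒ(f) where A_min is the curve of minimal height and f is the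
associated weight two newform.» … «the unique minimal lattice (whose existence is guaranteed by
Theorem 2.3) …».

THE OBJECTS, as printed.
* (2.1)(a) p. 84: «The lattice of Néron periods of `A` is defined by ℒ(A) = Image(H₁(A_ℂ, ℤ) → ℂ)»
  (integration of a Néron differential `ω_A`).  Tree: for a GLOBALLY MINIMAL model `V/ℚ` the
  invariant differential is a Néron differential and `IsNeronLatticeOf (V.baseChange ℂ) L` pins
  `L.lattice = Λ_E` (`ModularCurve.lean`).
* (2.3) p. 84: «**Theorem.** In any isogeny class 𝒜 of elliptic curves over ℚ there is a unique curve
  A_min ∈ 𝒜 which satisfies the following equivalent conditions (a) for every A ∈ 𝒜,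
  h(A_min) ≤ h(A); (b) for every A ∈ 𝒜 there is an étale isogeny φ : A_min → A; (c) for every
  A ∈ 𝒜, ℒ(A_min) ⊆ ℒ(A).»  Below, «`V` is the curve of minimal height» is rendered by condition
  (c): `Λ(V) ⊆ Λ(W)` for every globally minimal `W` ℚ-isogenous to `V` (tree `IsIsogenous`).
* (2.7)–(2.9) p. 88: «Let 𝒜 be a ℚ-isogeny class of modular elliptic curves of level N and let f be
  the associated weight 2 normalized newform. Integration of the differential 1-form f(q) dq/q over
  singular 1-cycles on X₁(N)_ℂ gives a linear map H₁(X₁(N)_ℂ; ℤ) → ℂ. The image of this map is a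
  lattice ℒ(f) ⊆ ℂ (2.7). … (2.9) **Conjecture I″.** Let A_min be the curve of minimal height in 𝒜.
  Then ℒ(f) = ℒ(A_min).»  Tree: `ℒ(f) = periodLatticeGamma1 f` (`ManinConstantGamma1ModularDegree`,
  the subgroup generated by the periods `{∞, γ∞}_f`, `γ ∈ Γ₁(N)`, = periods of `2πi f(τ)dτ = f(q)dq/q`
  over `H₁(X₁(N), ℤ)`), with `f` the newform of `V` (`IsNewformOf V f`, a newform on `Γ₀(N)`).
* (1.8) p. 81 «Conjectures I and I′ are equivalent», and p. 88 «Thus Conjecture I′ is equivalent to»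
  (2.9); the verification of (7.1) is carried out in the form (2.9) (p. 104, quoted above).

SCOPE (stated, not widened).  (i) The theorem covers the 749 curves of Antwerp IV Table 1, which is
«All elliptic curves of conductor N ≤ 200, arranged into isogeny classes» [cite: Cremona2006, §1.1
(LNCS 4076 p. 11–13)]; the hypothesis below is `conductor = N ≤ 200`.  (ii) Stevens' «level `N`» of
a modular isogeny class is the level of its newform; the rendering takes the newform `f` on `Γ₀(N)`
with `N` EQUAL to the conductor as an explicit hypothesis (Carayol's `level = conductor` is the
separate tree fact `IsNewformOf.level_eq_conductorNorm`, not used here).  (iii) Modularity of `V`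
is the hypothesis `IsNewformOf V f` (Stevens: «modular elliptic curves»).  Nothing else of §7 (the
seven classes whose minimal curve is not listed first; the tables on disk) is vendored.

## References
* [Stevens1989Invent] G. Stevens, Invent. Math. 98 (1989) 75–106, Thm. (7.1) p. 104; Conj. I″ (2.9)
  p. 88; Thm. (2.3) p. 84; Def. (2.1) p. 84; (2.7) p. 88.
* [Cremona2006] J. E. Cremona, *The elliptic curve database for conductors to 130000*, ANTS VII,
  LNCS 4076 (2006) 11–29, §1.1 (the Antwerp tables: Table 1 = all curves of conductor ≤ 200).
-/

open scoped MatrixGroups ModularForm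

open CongruenceSubgroup WeierstrassCurve

namespace Literature.NumberTheory.EllipticCurves.ModularForms

/-- **Stevens 1989, Theorem (7.1)** (p. 104; the sentence is quoted verbatim in the module docstring):
Stevens' statement I (1.3) holds for the 749 elliptic curves (281 isogeny classes) of conductor
`≤ 200` of the Antwerp tables — verified, as printed on p. 104, in the equivalent lattice form (2.9)
(p. 88): «Let A_min be the curve of minimal height in 𝒜. Then ℒ(f) = ℒ(A_min)», where `ℒ(f)` is the
lattice of periods of `f(q)dq/q` over `H₁(X₁(N)_ℂ; ℤ)` ((2.7); tree `periodLatticeGamma1 f`), `ℒ(A)`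
is the lattice of Néron periods ((2.1)(a); tree `IsNeronLatticeOf` of a globally minimal model) and
`A_min ∈ 𝒜` is the unique curve with `ℒ(A_min) ⊆ ℒ(A)` for every `A ∈ 𝒜` (Thm. (2.3)(c), p. 84).
A THEOREM in print (finite verification by modular symbols and AGM periods, §7), not a hypothesis.
Rendered special case (tree vocabulary; scope notes in the module docstring): for a globally minimal
`V/ℚ` of conductor `N ≤ 200` with newform `f` on `Γ₀(N)` and Néron period pair `L`, if `Λ(V) ⊆ Λ(W)`
for every globally minimal `W` ℚ-isogenous to `V` (i.e. `V` is Stevens' `A_min`), then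
`Λ₁(f) = Λ(V)` as subsets of `ℂ`.  The Antwerp Table 1 is the complete list of elliptic curves of
conductor `≤ 200` [cite: Cremona2006, §1.1].
[cite: Stevens1989Invent, Thm. (7.1) p. 104; statement (2.9) p. 88; Thm. (2.3)(c) p. 84] -/
def Stevens1989_thm_7_1_gamma1Lattice_conductor_le_200 : Prop :=
  ∀ (V : WeierstrassCurve ℚ) [V.IsElliptic] [V.IsGloballyMinimal] {N : ℕ} [NeZero N]
    (f : CuspForm (Gamma0 N) 2) (L : PeriodPair),
    V.conductorNorm ℤ = N → N ≤ 200 → IsNewformOf V f → IsNeronLatticeOf (V.baseChange ℂ) L →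
    (∀ (W : WeierstrassCurve ℚ) [W.IsElliptic] [W.IsGloballyMinimal] (LW : PeriodPair),
        IsIsogenous V W → IsNeronLatticeOf (W.baseChange ℂ) LW → L.lattice ≤ LW.lattice) →
    (periodLatticeGamma1 f : Set ℂ) = (L.lattice : Set ℂ)

/-- The CONTAINMENT half `Λ₁(f) ⊆ Λ(A_min)` of Stevens' Theorem (7.1) in conductor `≤ 200`, in the
pointwise shape consumed Summit-side (`…ManinAdditive.CMTwinStevensMinimalNetCount`:
`StevensGammaOneMinimalAt n`, `n ∈ {27, 32, 64}`, there with the level tied to the conductor by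
Carayol's fact). [cite: Stevens1989Invent, Thm. (7.1) p. 104] -/
theorem Stevens1989_thm_7_1_gamma1Lattice_conductor_le_200.periodLatticeGamma1_subset
    (h : Stevens1989_thm_7_1_gamma1Lattice_conductor_le_200)
    (V : WeierstrassCurve ℚ) [V.IsElliptic] [V.IsGloballyMinimal] {N : ℕ} [NeZero N]
    (f : CuspForm (Gamma0 N) 2) (L : PeriodPair) (hN : V.conductorNorm ℤ = N) (h200 : N ≤ 200)
    (hf : IsNewformOf V f) (hL : IsNeronLatticeOf (V.baseChange ℂ) L)
    (hmin : ∀ (W : WeierstrassCurve ℚ) [W.IsElliptic] [W.IsGloballyMinimal] (LW : PeriodPair),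
        IsIsogenous V W → IsNeronLatticeOf (W.baseChange ℂ) LW → L.lattice ≤ LW.lattice) :
    ∀ z ∈ periodLatticeGamma1 f, z ∈ L.lattice := by
  intro z hz
  have hset := h V f L hN h200 hf hL hmin
  have hz' : z ∈ (periodLatticeGamma1 f : Set ℂ) := hz
  rw [hset] at hz'
  exact hz'

/-- The reverse half `Λ(A_min) ⊆ Λ₁(f)` of Stevens' Theorem (7.1) in conductor `≤ 200` (the
equality (2.9), read from right to left). [cite: Stevens1989Invent, Thm. (7.1) p. 104] -/
theorem Stevens1989_thm_7_1_gamma1Lattice_conductor_le_200.lattice_subset_periodLatticeGamma1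
    (h : Stevens1989_thm_7_1_gamma1Lattice_conductor_le_200)
    (V : WeierstrassCurve ℚ) [V.IsElliptic] [V.IsGloballyMinimal] {N : ℕ} [NeZero N]
    (f : CuspForm (Gamma0 N) 2) (L : PeriodPair) (hN : V.conductorNorm ℤ = N) (h200 : N ≤ 200)
    (hf : IsNewformOf V f) (hL : IsNeronLatticeOf (V.baseChange ℂ) L)
    (hmin : ∀ (W : WeierstrassCurve ℚ) [W.IsElliptic] [W.IsGloballyMinimal] (LW : PeriodPair),
        IsIsogenous V W → IsNeronLatticeOf (W.baseChange ℂ) LW → L.lattice ≤ LW.lattice) :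
    ∀ z ∈ L.lattice, z ∈ periodLatticeGamma1 f := by
  intro z hz
  have hset := h V f L hN h200 hf hL hmin
  have hz' : z ∈ (L.lattice : Set ℂ) := hz
  rw [← hset] at hz'
  exact hz'

end Literature.NumberTheory.EllipticCurves.ModularForms
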